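import Summits.ValiantsHypothesis.ValiantsHypothesis.Theorems.BarrierLeverChowHitsPartitionMinorsRHybridBase
import Summits.ValiantsHypothesis.ValiantsHypothesis.Theorems.BarrierLeverChowHitsPartitionMinorsRFacePrivateColumns

/-!
# Route BarrierLever — item `ChowHitsPartitionMinorsR` (stmt-ValiantsHypothesis-21882):
# THEOREM H (hybrid design), file 3 — THE COLUMN STRUCTURE `P = (A + X·R)·diag` of the normalised hybrid product

Helper file (`--supports stmt-ValiantsHypothesis-21882`; cell valiant-natproofs, rung V4, 𝒟-side support item of route
BarrierLever; prover seat val-np-p5 gen 32; seat memo MEMO-21882-valnp5-g32.md §6 «THEOREM H», kernel step K-H3). Closes NO item.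
Builds on `…RHybridBase` (p732352: base convolution) and THEOREM FP's column lemmas `…FacePrivateColumns`
(`coeff_prod_group_empty`, `coeff_prod_group_column`, `dvd_coeff_prod_group`).

SETTING. Injective lower-set rows `u`, injective columns `w`; `z j` ⇔ the column `w j` is a row (a COMMON column); the DEFECT
columns `{j // ¬ z j}` carry groups `G_j` whose square-free coefficients are those of a pure-`x` polynomial `Q_j` plus a SPIKE
`X₀^{m j}` at `(∅, w j)` (size-graded exponents: `M ≤ m j < 2M`, and `m j' > m j` whenever `|w j'| < |w j|`). Then
(`hybrid_columns`) every entry of the partition matrix of `(∏_a φ_a) · ∏_j G_j` is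
  `(A[i,j] + X₀·ρ) · 1`          for a common column (`A[i,j] = (−1)^{|w j|}[w j ⊆ u i] coeff_{x^{u i∖w j}} ∏ Q`),
  `(A[i,j] + X₀·ρ) · X₀^{m j}`   for a defect column (`A[i,j] = coeff_{x^{u i}} ∏_{j' ≠ j} Q_{j'}`),
the shape consumed by `ChowFacePrivate.det_ne_zero_of_columns`, with `A` the matrix of `…RHybridLeading.det_leadingHybrid_ne_zero`.

WHAT THIS IS NOT: THEOREM H is assembled in the last file of the chain; nothing here on item 21882's truth, crux 14610 or `VP ≠ VNP`.
-/

set_option linter.dupNamespace false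

namespace Summit.ValiantsHypothesis.ValiantsHypothesis.Theorems.BarrierLever.ChowHybrid

open Finset MvPolynomial
open Summit.ValiantsHypothesis.ValiantsHypothesis.Theorems.BarrierLever.ChowFacePrivate
  (coeff_prod_group_empty coeff_prod_group_column dvd_coeff_prod_group)

noncomputable section

variable {h r : ℕ} {R' : Type*} [CommRing R']

/-- A defect column is not contained in any row (rows form a lower set). -/
theorem not_subset_of_defect {u w : Fin r → Finset (Fin h)} (hlu : IsLowerSet (Set.range u)) {j : Fin r}
    (hj : ¬ ∃ i, u i = w j) (i : Fin r) : ¬ w j ⊆ u i := by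
  intro hsub
  obtain ⟨k, hk⟩ := hlu (show w j ≤ u i from hsub) ⟨i, rfl⟩
  exact hj ⟨k, hk⟩

/-- **THE COLUMN STRUCTURE OF THE NORMALISED HYBRID PRODUCT.** -/
theorem hybrid_columns (u w : Fin r → Finset (Fin h)) (hw : Function.Injective w)
    (hlu : IsLowerSet (Set.range u)) (z : Fin r → Prop) [DecidablePred z] (hz : ∀ j, z j ↔ ∃ i, u i = w j)
    (X₀ : R') (M : ℕ) (m : Fin r → ℕ) (hM : 1 ≤ M) (hmM : ∀ j, ¬ z j → M ≤ m j)
    (hm2 : ∀ j, ¬ z j → m j + 1 ≤ 2 * M)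
    (hmono : ∀ j j', ¬ z j → ¬ z j' → (w j').card < (w j).card → m j + 1 ≤ m j')
    (G Q : {j : Fin r // ¬ z j} → MvPolynomial (Fin (h + h)) R')
    (hQ : ∀ (j : {j : Fin r // ¬ z j}) (S T : Finset (Fin h)), T ≠ ∅ →
      coeff (∑ a ∈ S, Finsupp.single (Fin.castAdd h a) 1 + ∑ c ∈ T, Finsupp.single (Fin.natAdd h c) 1) (Q j) = 0)
    (hG : ∀ (j : {j : Fin r // ¬ z j}) (S T : Finset (Fin h)),
      coeff (∑ a ∈ S, Finsupp.single (Fin.castAdd h a) 1 + ∑ c ∈ T, Finsupp.single (Fin.natAdd h c) 1) (G j) =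
      coeff (∑ a ∈ S, Finsupp.single (Fin.castAdd h a) 1 + ∑ c ∈ T, Finsupp.single (Fin.natAdd h c) 1) (Q j) +
        (if S = ∅ ∧ T = w j.1 then X₀ ^ (m j.1) else 0))
    (i j : Fin r) :
    ∃ ρ : R', coeff (∑ a ∈ u i, Finsupp.single (Fin.castAdd h a) 1 + ∑ c ∈ w j, Finsupp.single (Fin.natAdd h c) 1)
        ((∏ a, (phi a : MvPolynomial (Fin (h + h)) R')) * ∏ j', G j') =
      ((if hj : z j then
          (-1 : R') ^ (w j).card * (if w j ⊆ u i then coeff (∑ a ∈ u i \ w j, Finsupp.single (Fin.castAdd h a) 1 +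
            ∑ c ∈ (∅ : Finset (Fin h)), Finsupp.single (Fin.natAdd h c) 1) (∏ j', Q j') else 0)
        else coeff (∑ a ∈ u i, Finsupp.single (Fin.castAdd h a) 1 +
            ∑ c ∈ (∅ : Finset (Fin h)), Finsupp.single (Fin.natAdd h c) 1)
          (∏ j' ∈ (Finset.univ : Finset {j : Fin r // ¬ z j}).erase ⟨j, hj⟩, Q j')) + X₀ * ρ) *
        (if z j then 1 else X₀ ^ (m j)) := by
  classical
  -- the spikes in FP's shape `t * c j`
  set t : R' := X₀ ^ M with ht
  set c : {j : Fin r // ¬ z j} → R' := fun j' => X₀ ^ (m j'.1 - M) with hc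
  have htc : ∀ j' : {j : Fin r // ¬ z j}, t * c j' = X₀ ^ (m j'.1) := by
    intro j'
    rw [ht, hc, ← pow_add, Nat.add_sub_cancel' (hmM j'.1 j'.2)]
  have hG' : ∀ (j' : {j : Fin r // ¬ z j}) (S T : Finset (Fin h)),
      coeff (∑ a ∈ S, Finsupp.single (Fin.castAdd h a) 1 + ∑ c ∈ T, Finsupp.single (Fin.natAdd h c) 1) (G j') =
      coeff (∑ a ∈ S, Finsupp.single (Fin.castAdd h a) 1 + ∑ c ∈ T, Finsupp.single (Fin.natAdd h c) 1) (Q j') +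
        (if S = ∅ ∧ T = w j'.1 then t * c j' else 0) := by
    intro j' S T; rw [hG, htc]
  -- the empty set is a row, hence defect columns are nonempty
  have hempty_row : ∃ i₀, u i₀ = ∅ := by
    obtain ⟨k, hk⟩ := hlu (show (∅ : Finset (Fin h)) ≤ u i from Finset.empty_subset _) ⟨i, rfl⟩
    exact ⟨k, hk⟩
  have hW : ∀ j' : {j : Fin r // ¬ z j}, w j'.1 ≠ ∅ := by
    intro j' e
    apply j'.2
    rw [hz]
    obtain ⟨i₀, hi₀⟩ := hempty_row
    exact ⟨i₀, hi₀.trans e.symm⟩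
  have hWinj : Function.Injective (fun j' : {j : Fin r // ¬ z j} => w j'.1) :=
    fun a b e => Subtype.ext (hw e)
  -- FP's three facts for the product of the groups
  have F1 := coeff_prod_group_empty G Q (fun j' => w j'.1) c t hG' hW Finset.univ
  have F2 := dvd_coeff_prod_group G Q (fun j' => w j'.1) c t hQ hG' hW Finset.univ
  have F3 := fun (j' : {j : Fin r // ¬ z j}) (U : Finset (Fin h)) =>
    coeff_prod_group_column G Q (fun j' => w j'.1) c t hQ hG' hW hWinj Finset.univ j' (Finset.mem_univ _) U
  -- abbreviation for the group-product coefficients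
  set Gh : Finset (Fin h) → Finset (Fin h) → R' := fun U T =>
    coeff (∑ a ∈ U, Finsupp.single (Fin.castAdd h a) 1 + ∑ c ∈ T, Finsupp.single (Fin.natAdd h c) 1) (∏ j', G j')
    with hGh
  have hX0M : X₀ ∣ t := by
    rw [ht]
    obtain ⟨M', hM'⟩ : ∃ M', M = M' + 1 := ⟨M - 1, by omega⟩
    rw [hM', pow_succ]
    exact dvd_mul_left X₀ _
  -- the base convolution
  rw [coeff_partitionExpo_baseNormal_mul]
  by_cases hzj : z j
  · ---- common column
    rw [dif_pos hzj, if_pos hzj]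
    -- every term with `T ≠ w j` is a multiple of `X₀`
    have hdvd : ∀ T ∈ ((u i ∩ w j).powerset).erase (w j),
        X₀ ∣ (-1 : R') ^ T.card * Gh (u i \ T) (w j \ T) := by
      intro T hT
      have hT := Finset.mem_erase.mp hT
      have hTsub : T ⊆ w j := (Finset.mem_powerset.mp hT.2).trans Finset.inter_subset_right
      have hne : w j \ T ≠ ∅ := by
        intro e
        exact hT.1 (Finset.Subset.antisymm hTsub (Finset.sdiff_eq_empty_iff_subset.mp e))
      exact (hX0M.trans (F2 (u i \ T) (w j \ T) hne).1).mul_left _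
    obtain ⟨ρ, hρ⟩ := Finset.dvd_sum hdvd
    by_cases hsub : w j ⊆ u i
    · have hmem : w j ∈ (u i ∩ w j).powerset := by
        rw [Finset.mem_powerset]; exact Finset.subset_inter hsub (Finset.Subset.refl _)
      refine ⟨ρ, ?_⟩
      rw [mul_one, if_pos hsub, ← Finset.add_sum_erase _ _ hmem, hρ, Finset.sdiff_self]
      have hF1 : coeff (∑ a ∈ u i \ w j, Finsupp.single (Fin.castAdd h a) 1 +
          ∑ c ∈ (∅ : Finset (Fin h)), Finsupp.single (Fin.natAdd h c) 1) (∏ j', G j') =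
          coeff (∑ a ∈ u i \ w j, Finsupp.single (Fin.castAdd h a) 1 +
          ∑ c ∈ (∅ : Finset (Fin h)), Finsupp.single (Fin.natAdd h c) 1) (∏ j', Q j') := F1 (u i \ w j)
      rw [hF1]
    · refine ⟨ρ, ?_⟩
      have hnotmem : w j ∉ (u i ∩ w j).powerset := by
        rw [Finset.mem_powerset]
        intro hh
        exact hsub (hh.trans Finset.inter_subset_left)
      rw [mul_one, if_neg hsub, mul_zero, zero_add, ← hρ, Finset.erase_eq_of_notMem hnotmem]
  · ---- defect column
    rw [dif_neg hzj, if_neg hzj]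
    have hjdef : ¬ ∃ i', u i' = w j := fun hh => hzj ((hz j).mpr hh)
    set jj : {j : Fin r // ¬ z j} := ⟨j, hzj⟩ with hjj
    -- the `T = ∅` term
    obtain ⟨r₀, hr₀⟩ := F3 jj (u i)
    -- every `T ≠ ∅` term is a multiple of `X₀ ^ (m j + 1)`
    have hdvd : ∀ T ∈ ((u i ∩ w j).powerset).erase ∅,
        X₀ ^ (m j + 1) ∣ (-1 : R') ^ T.card * Gh (u i \ T) (w j \ T) := by
      intro T hT
      have hT := Finset.mem_erase.mp hT
      have hTsub : T ⊆ u i ∩ w j := Finset.mem_powerset.mp hT.2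
      have hB : w j \ T ≠ ∅ := by
        intro e
        apply not_subset_of_defect hlu hjdef i
        exact (Finset.sdiff_eq_empty_iff_subset.mp e).trans (hTsub.trans Finset.inter_subset_left)
      have hBlt : (w j \ T).card < (w j).card := by
        apply Finset.card_lt_card
        refine lt_of_le_of_ne Finset.sdiff_subset fun e => ?_
        have : T ∩ w j = ∅ := by
          have := Finset.sdiff_eq_self_iff_disjoint.mp e
          exact Finset.disjoint_iff_inter_eq_empty.mp this.symm
        apply hT.1
        rw [← Finset.inter_eq_left.mpr (hTsub.trans Finset.inter_subset_right), this]
      refine Dvd.dvd.mul_left ?_ _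
      by_cases hcol : ∃ j' : {j : Fin r // ¬ z j}, w j'.1 = w j \ T
      · obtain ⟨j', hj'⟩ := hcol
        obtain ⟨r', hr'⟩ := F3 j' (u i \ T)
        rw [hGh]
        simp only
        rw [← hj', hr', htc]
        refine dvd_add ?_ ?_
        · have hle : m j + 1 ≤ m j'.1 := hmono j j'.1 hzj j'.2 (by rw [hj']; exact hBlt)
          exact (pow_dvd_pow X₀ hle).mul_right _
        · rw [ht, ← pow_add]
          exact (pow_dvd_pow X₀ (by have := hm2 j hzj; omega)).mul_right _
      · push Not at hcol
        have h2 := (F2 (u i \ T) (w j \ T) hB).2 (fun j' _ => hcol j')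
        rw [ht, ← pow_add] at h2
        exact (pow_dvd_pow X₀ (by have := hm2 j hzj; omega)).trans h2
    obtain ⟨ρ₁, hρ₁⟩ := Finset.dvd_sum hdvd
    have hmem : (∅ : Finset (Fin h)) ∈ (u i ∩ w j).powerset := Finset.mem_powerset.mpr (Finset.empty_subset _)
    refine ⟨X₀ ^ (2 * M - (m j + 1)) * r₀ + ρ₁, ?_⟩
    have hr₀' : coeff (∑ a ∈ u i, Finsupp.single (Fin.castAdd h a) 1 + ∑ c ∈ w j, Finsupp.single (Fin.natAdd h c) 1)
        (∏ j', G j') = t * c jj * coeff (∑ a ∈ u i, Finsupp.single (Fin.castAdd h a) 1 +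
          ∑ c ∈ (∅ : Finset (Fin h)), Finsupp.single (Fin.natAdd h c) 1) (∏ j' ∈ Finset.univ.erase jj, Q j') +
        t * t * r₀ := hr₀
    rw [← Finset.add_sum_erase _ _ hmem, hρ₁, Finset.card_empty, pow_zero, one_mul]
    rw [Finset.sdiff_empty, Finset.sdiff_empty, hr₀', htc, ht, ← pow_add]
    have e2 : X₀ ^ (M + M) = X₀ ^ (m j) * X₀ * X₀ ^ (2 * M - (m j + 1)) := by
      rw [← pow_succ, ← pow_add]
      congr 1
      have := hm2 j hzj
      omega
    rw [e2, pow_succ]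
    ring

end

end Summit.ValiantsHypothesis.ValiantsHypothesis.Theorems.BarrierLever.ChowHybrid
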